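import Mathlib
import HarnessLib
import HarnessLib.Audit
import Summits.QuantumAdvantage.Statement
import Summits.QuantumAdvantage.AdviceFreeQNC0.AdviceFreeQNC0
import Summits.QuantumAdvantage.AdviceFreeQNC0.RingHardOdd
import Summits.QuantumAdvantage.AdviceFreeQNC0.AdviceFreeQNC0Three
import Summits.QuantumAdvantage.AdviceFreeQNC0.NPGamma37FourierLoss
import Summits.QuantumAdvantage.AdviceFreeQNC0.AffBells37PolyLoss
import Summits.QuantumAdvantage.AdviceFreeQNC0.BondTwistLocal
import Summits.QuantumAdvantage.QuantumAdvantage.Theorems.RingFrameBridge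
import HarnessLib.Audit.Status.Attr

/-!
Route: FormsDichotomy

# Route FormsDichotomy — Few own linear forms versus far-from-few-forms at polynomial loss - a
proved partition of ProductDial's PolyLoss3 with the special side cornered by three theorems (rung
F-Q1-p3)

DECOMPOSITION CELL decomp-qadv (D-0178/D-0179), RESIDUAL MODE, node FormsDichotomy (lens
decomp-qadv-lens-2 g4 «peel a cornered special
class», NODE v2 2026-08-30T04:09:55Z sha256 daf6ffe9… = cleared file of record, v3 78f5fa2e… = v2 +
pure additions (glue PROVED + spectral
split), 812 lines, lean check rc0 · 0 sorry · axioms standard; critic decomp-qadv-crit-1 g2 row 20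
CLEARED 04:14:29Z as refines-child of
ProductDial:26123, ACK-v3 04:21:58Z). RUNG CURRENCY ONLY — nothing here bears on the root
`QuantumAdvantage`. T = ProductDial's crux
PolyLoss3 (stmt-QuantumAdvantage-26123: at every polylog degree the 𝔽₃ ring game on the n-cycle is
lost on at least a 2ⁿ/n^k fraction,
ONE k) — itself already below T* = MultiRingHard3 < RingHardOdd 3 (ProductDial's bypass). SHAPE B
(sibling route, ProductDial is at its
15-item cap): it suffices to show X = FewFormsPolyLoss3 ∧ FarFewFormsPolyLoss3, the PROVED PARTITION
of PolyLoss3 by the class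
S = «every output bit is a function of at most (log₂ n)^c OWN linear forms mod 3» (law
`partition_iff_poly S`, every class S,
kernel-checked; instance `node_iff_poly : PolyLoss3 ↔ L* ∧ H*`): L* = the special strategies lose
polynomially (crux r2, OPEN but
CORNERED by three theorems: level 1 poly loss k = 8 PROVED = tree
`NPGamma37Proof.ringHardLinForms3_explicit`; quasi-polynomial loss
PROVED at EVERY level `fewForms_quasiLossOdd3`; cyclically-local forms PROVED at every level
`localPolyLoss3`) and H* = strategies
2ⁿ/n^k-FAR from every special strategy lose polynomially (crux r3, the DECLARED RESIDUAL ≡ PolyLoss3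
mod L*: the inverse theorem
«near-perfect ⇒ near-few-forms»). X → T is the support FormsSplitGlue3 (PROVED,
`formsSplitGlue3_holds`); T → leaf is ProductDial's
cone shared VERBATIM (DPLift3 26124 declared residual there, MultiRingBridge3 26125 PROVED in the
ProductDial node).
Lean: `∃ k : ℕ, ∀ c : ℕ, ∃ n₀ : ℕ, ∀ n ≥ n₀, ∀ P : Fin n →
Literature.Computability.MetaComplexity.Smolensky.CubeFn (ZMod 3) n, (∀ i, P i ∈
Literature.Computability.MetaComplexity.Smolensky.lowDeg (ZMod 3) n ((Nat.log 2 n) ^ c)) →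
((Finset.univ.filter fun x : Fin n → Bool => Literature.Computability.QuantumComplexity.RingHLF.Rel
x (fun i => decide (P i x = 1))).card : ℝ) ≤ (1 - 1 / (n : ℝ) ^ k) * (2 : ℝ) ^ n`

## Assembly
Inside `closes` (glue.lean, one line, 0 sorry): `adviceFreeQNC0Three_iff.mpr
(Theorems.adviceFreeQNC0Sep_of_hlfNotFAC0Mod 3 (hB (hD (hG hL hH))))` —
the glue FormsSplitGlue3 turns L* ∧ H* into PolyLoss3, ProductDial's residual DPLift3 gives T* =
MultiRingHard3, its PROVED bridge gives
HLFNotFAC0Mod 3, and the landed `Theorems.adviceFreeQNC0Sep_of_hlfNotFAC0Mod` with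
`adviceFreeQNC0Three_iff` concludes the leaf F-Q1-p3.
Binders consumed 5/5 (open cruxes FewFormsPolyLoss3, FarFewFormsPolyLoss3, DPLift3; supports
FormsSplitGlue3 PROVED-in-node, MultiRingBridge3
PROVED in the ProductDial node). Writer sketch sk/FormsDichotomySketch.lean: 12 Iff.rfl certificates
(4 ↔ ProductDial tree decls by name,
8 ↔ node), formsSplitGlue3_holds, fewFormsPolyLossOne3_holds, necessity halves, fewForms_split_two,
closes, example through ProductDial's binders; rc0 · 0 sorry.

CLOSES_TARGET: closes rung F-Q1-p3 of QuantumAdvantage: Summit.QuantumAdvantage.AdviceFreeQNC0.AdviceFreeQNC0Three (D-0061; not the summit Statement) — the deciding theorem of this route concludes that registered leaf instead of the Statement decl `QuantumAdvantage` (class rung: servable and labelled, never counted as concluding the summit Statement).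

Rationale: WHY THIS LINE. The node's content is the CHOICE of S and the GRADE (critic): poly loss is the first
grade at which the few-forms class is open
at polylog dimension, and the grade × dimension table is now theorem-backed on three sides —
exactness and quasi-poly loss for
ALL dimensions ≤ (n−8)/12 − 2log₂n (`linForms_not_perfectOdd3` ⇒ R₃*(n) ≥ n/12 − O(log n), NEW;
`linForms_quasiLossOdd3_explicit`,
NEW), poly loss at dimension log₂n (tree, k = 8), poly loss for local forms at every level. The open
content of L* is exactly the
9^−R room of the tree's `NPGamma37Proof.fourierLoss` (quasi → poly at Fourier dimension (log n)^≥2),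
with a typed ceiling lift
(aside SparseFormsPolyLoss3All: support-indexed character families, loss n^−O(a) independent of R)
and a typed core (aside
DenseFormsPolyLoss3Two: spread-spectrum tables). Imported areas: polynomial method over two moduli
(Smolensky doi:10.1145/28395.28404;
Barrington–Beigel–Rudich doi:10.1007/BF01263422; Green doi:10.1016/j.jcss.2004.01.003), 𝔽₃-character
sums / Fourier sparsity
(tree NPGamma37Fourier*), correlation bounds for polynomials (Viola–Wigderson
doi:10.4086/toc.2008.v004a007, Viola FOCS 2008
doi:10.1109/FOCS.2008.18), the BGK ring game (arXiv:1704.00690 §4) and its p = 3 rung question (WKST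
arXiv:1906.08890, GK arXiv:2408.16406).

RANKED CRUXES. #0 PolyLoss3 (target) — T = ProductDial's crux stmt-QuantumAdvantage-26123 (body
VERBATIM, shared item; rank-0 record here): some k such that at every polylog degree, for all large
n, every 𝔽₃ strategy wins the ring game on at most (1 − n^−k)·2ⁿ patterns. PARTITIONED by this route
as L* ∧ H* (node_iff_poly, PROVED). [deps: FewFormsPolyLoss3, FarFewFormsPolyLoss3, FormsSplitGlue3]
[difficulty: open-problem] (why it might fail: a polylog-degree family winning 1 − n^−ω(1) (none
known: every census family M0/M2 is few-forms and loses polynomially); it fails iff L* or H* fails.)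
[arXiv:1704.00690, doi:10.1145/28395.28404, arXiv:2408.16406]
#2 FewFormsPolyLoss3 (crux) — L* (the SPECIAL side, NECESSARY, WEAKER, OPEN-but-CORNERED): some k
such that at every level c, for all large n, every polylog-degree strategy whose every output bit is
a function of at most (log₂ n)^c OWN linear forms mod 3 wins the ring game on at most (1 − n^−k)·2ⁿ
of all patterns. Level 1 PROVED (k = 8, tree `NPGamma37Proof.ringHardLinForms3_explicit` ⇒ node
`fewFormsPolyLoss3_one`, filed as aside FewFormsPolyLossOne3 = BC5 rung); quasi-poly loss PROVED at
every level (`fewForms_quasiLossOdd3`); local forms PROVED at every level (`localPolyLoss3`); open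
content = quasi → poly at Fourier dimension (log n)^≥2. ATTACKABLE (engine
`NPGamma37Proof.fourierLoss`; spectral split L* ↔ SparseFormsPolyLoss3 a ∧ DenseFormsPolyLoss3 a
PROVED every a) · INSTRUMENTABLE (census C1: loss-exponent fit of few-forms families). [difficulty:
L] (why it might fail: a level-2 few-forms family (tables on (log n)² staggered forms, spread
spectrum) whose loss decays like n^−ω(1) — exactly the 9^−R room the Fourier method leaves
(DenseFormsPolyLoss3Two is the core).) [arXiv:1704.00690, doi:10.1145/28395.28404,
doi:10.1016/j.jcss.2004.01.003]
#3 FarFewFormsPolyLoss3 (crux) — H* (the GENERIC side, DECLARED RESIDUAL · NO-SHRINK ≡ PolyLoss3 mod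
L*; NECESSARY; hypotheses satisfiable — generic degree-2 maps are n^−k-far from every few-forms
map): for every closeness exponent k a loss exponent k′: at every level c, for all large n, every
polylog-degree strategy disagreeing with every special strategy of the same level on ≥ 2ⁿ/n^k
patterns wins on at most (1 − n^−k′)·2ⁿ — the INVERSE THEOREM «near-perfect ⇒ near-few-forms», typed
form of NPGamma37's residual «high 𝔽₃-Fourier dimension». IDEA-NEEDED (first rung: quadratic phases
= ProductDial aside PolyLossTwo3 26127; Bourgain / Viola–Wigderson parity-vs-MOD₃ sums decay like
exp(−n/4^d), vacuous at d ≳ log n); UNDECIDED with test census C2 (Fourier-dimension profile of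
near-optimal non-affine families). [difficulty: open-problem] (why it might fail: only together with
PolyLoss3: a high-Fourier-dimension polylog-degree family winning 1 − n^−ω(1); structurally, inverse
theorems for MOD₃-vs-parity correlation at degree ≳ log n are beyond every known bound.)
[doi:10.4086/toc.2008.v004a007, doi:10.1109/FOCS.2008.18, arXiv:1704.00690,
doi:10.1016/j.jcss.2004.01.003]
#4 DPLift3 (crux) — ProductDial's declared residual stmt-QuantumAdvantage-26124 (body VERBATIM,
shared item, staffed there): PolyLoss3 → MultiRingHard3 (direct-product lift from one ring with
1/poly loss to n^K disjoint rings all won with probability ≤ θ). [deps: PolyLoss3] [difficulty: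
open-problem] (why it might fail: XOR/direct-product lemmas for polylog-degree 𝔽₃ polynomials
against a RELATION are not in print; Viola–Wigderson-type products lose the degree budget.)
[doi:10.4086/toc.2008.v004a007, arXiv:1704.00690]
#9 FormsSplitGlue3 (support) — the refines-glue X → T, PROVED in the node v3 (`formsSplitGlue3_holds
:= fun hL hH => node_iff_poly.mpr ⟨hL, hH⟩`, critic ACK 04:21:58Z; closable in one line by tree
names once landed): FewFormsPolyLoss3 → FarFewFormsPolyLoss3 → PolyLoss3 (close case with closeness
exponent k_L+1, far case by H*, exponent max). [deps: FewFormsPolyLoss3, FarFewFormsPolyLoss3]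
[difficulty: S] [arXiv:1704.00690]
#9 MultiRingBridge3 (support) — ProductDial's bridge stmt-QuantumAdvantage-26125 (body VERBATIM,
shared, PROVED in the ProductDial node): MultiRingHard3 → HLFNotFAC0Mod 3. [deps: MultiRingHard3]
[difficulty: S] [arXiv:1704.00690, doi:10.1145/28395.28404]
#9 MultiRingHard3 (support) — ProductDial's target T* stmt-QuantumAdvantage-26122 (body VERBATIM,
shared record; needed by DPLift3 / MultiRingBridge3 by name). [difficulty: open-problem]
[arXiv:1704.00690]
#9 FewFormsPolyLossOne3 (support) — aside — THE FIRST RUNG of L*, PROVED (node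
`fewFormsPolyLoss3_one` from tree `NPGamma37Proof.ringHardLinForms3_explicit`, k = 8, N ≥ 200):
level c = 1 (log₂ n own forms) few-forms strategies lose polynomially. BC5 witness of the route
(tree theorem by name; lies outside S's known regime: RingHardOdd 3 / PolyLoss3 are open at every
level ≥ 1 for general strategies). [difficulty: S] [arXiv:1704.00690]
#9 SparseFormsPolyLoss3All (support) — aside — the typed CEILING LIFT inside L* (ATTACKABLE, size M;
= BC9 ceiling_lift): for every sparsity exponent a ONE loss exponent at all levels for few-forms
strategies whose tables have ≤ n^a nonzero 𝔽₄-Fourier coefficients (tree `NPGamma37Proof.fc`) —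
refactor `fourierLoss` with support-indexed character families (K′ = (n+1)·2·(n^a+4F), loss n^−O(a)
independent of R); NOT a corollary of tree RingHardFourierSparse3 (monomial-support sparsity at R ≤
log₂N). a = 2 contains level 1 entirely (`sparseForms_two_of_fewForms_one`). [difficulty: M]
[arXiv:1704.00690, doi:10.1016/j.jcss.2004.01.003]
#9 DenseFormsPolyLoss3Two (support) — aside — the IDEA-NEEDED CORE of L* at a = 2 (≡ L* mod
SparseFormsPolyLoss3 2, `fewForms_spectral_split 2` PROVED; EMPTY at c ≤ 1 PROVED): few-forms
strategies with some output admitting no n²-sparse representation (balanced spread-spectrum tables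
of (log₂ n)^≥2 non-local forms: majority / inner-product / random tables of MOD₃ tests) lose
polynomially. No engine in the tree reaches it (fourierLoss pays support size; derivative/Gowers
methods capped by NonclassicalDegreeLogBarrier; locality needs cyclically local supports).
[difficulty: L] [doi:10.1016/j.jcss.2004.01.003, doi:10.4086/toc.2008.v004a007]
#9 FewFormsHard3 (support) — aside — the CONSTANT-grade twin of L* (g3's special binder; record of
the grade × dimension table): few-forms strategies win at most θ·2ⁿ, one θ < 1 for all levels.
[difficulty: L] [arXiv:1704.00690]
#9 FarFromFewFormsHard3 (support) — aside — the CONSTANT-grade twin of H* (g3's generic binder;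
`closes_const` in the node reaches the leaf from the two constant-grade twins via RingHard 3
directly). [difficulty: open-problem] [arXiv:1704.00690, doi:10.4086/toc.2008.v004a007]

TWO-LAYER PLAN. FewFormsPolyLoss3 ⇐ SparseFormsPolyLoss3All (ceiling lift of fourierLoss, size M,
stub) ∧ DenseFormsPolyLoss3Two (core, IDEA-NEEDED, stub) via the
PROVED spectral split `fewForms_spectral_split 2` (BC3 skeleton bc-fd/FewFormsPolyLoss3_birth.lean).
FarFewFormsPolyLoss3 is the declared
residual: first rung quadratic phases (ProductDial aside PolyLossTwo3 26127), no decomposition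
filed.

KILL CRITERIA. A level-c few-forms family with loss n^−ω(1) refutes L* (and PolyLoss3, and flags
ProductDial:26123): close --reason refuted:FewFormsPolyLoss3.
A high-Fourier-dimension near-perfect family refutes H* and PolyLoss3 together. Census C1/C2 (lens
instruments) are the early-warning
tests; DPLift3 refuted kills this route with ProductDial's cone (shared binder).

NOT DECOMPOSED YET. H* stays whole (residual by design). L*'s split into sparse/dense is typed as
asides + skeleton, not as route children (cap discipline,
and the dense core has no plan yet).

CHEAPEST FALSIFIER. Census C1 (kit minutes, lens instrument): fit the loss exponent of the best
level-2 few-forms families (tables on (log₂ n)² staggered /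
random forms) for n ≤ 22 by exact DP — a loss decaying faster than any fixed power across n = 12…22
is a refutation signal for L*;
second, the in-Lean check that DenseFormsPolyLoss3 2 is NON-EMPTY at c = 2 for small n (else the
core is vacuous and L* reduces to the
sparse rung). Neither run by the writer (kit_allowed = false).

NUMBERS. Level-1 rung: k = 8 (7 + 1 for all patterns), N ≥ 200, R ≤ log₂ N (tree
`ringHardLinForms3_explicit`). Exactness/quasi-loss table: all
dimensions R with 12R + 24 log₂ N + 8 ≤ N (`linForms_not_perfectOdd3`,
`linForms_quasiLossOdd3_explicit`) ⇒ R₃*(n) ≥ n/12 − O(log n).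
Sparse rung bookkeeping (plan): K′ = (n+1)·2·(n^a + 4F), 8·n^a·(n+1)·3^F ≤ 4^F, 32(n+1)F ≤ 2^F, loss
2ⁿ/(8(K′+1)²) = n^−O(a).

DEFINITION REQUESTS. None: all items are stated over tree constants (`Smolensky.CubeFn/lowDeg`,
`RingHLF.Rel`, `NPGamma37Proof.fc`); the class predicates
fewForms / sparseForms are INLINED (lambda tables on (log₂ n)^c forms; Fourier support ≤ n^a).

Novelty: Searches (lens g3/g4 + writer, 2026-08-30): tree `rg 'fewForms|LinForms|FourierSparse'
Summits/QuantumAdvantage/AdviceFreeQNC0` (hits: NPGamma37FourierLoss ringHardLinForms3 (level 1),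
RingHardFourierSparse3 (monomial sparsity) — no poly-loss statement at polylog dimension); `lit
search --hybrid "MOD 3 versus parity correlation bounds low degree polynomials few linear forms"` →
[corpus: Viola–Wigderson ToC 2008 doi:10.4086/toc.2008.v004a007 §1] (exp(−n/4^d) decay, vacuous at d
≳ log n), [corpus: Green JCSS 2004 doi:10.1016/j.jcss.2004.01.003] (parity vs quadratic MOD₃); `lit
galaxy search "symmetric polynomials over Z_m|MOD_m gates|two moduli" --star all` → [galaxy:pdf:
Barrington–Beigel–Rudich doi:10.1007/BF01263422], [galaxy:pdf: Grigoriev–Razborov]; no hits for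
"inverse theorem near-perfect ring game few linear forms" in corpus (fts+vec) and galaxy.
Nearest prior art found: in tree, ProductDial:26123 (the target), PumpingDial's FS(q,3,r) classes ⊂
fewForms (junction 27316 ⟸ L* at matching level, partial credit), DegreeGrowthDial's exactness digit
(same census data, different instrument), tree RingHardFourierSparse3; in print, correlation bounds
for low-degree 𝔽₃/𝔽₂ polynomials (Viola–Wigderson, Bourgain, Green) which stop at degree ≪ log n.
Delta: the first typed partition of the p = 3 polynomial-loss ring crux by Fourier DIMENSION of the
strategy (few own linear forms vs far from them) with the special side cornered by three kernel
theorems (level 1 poly, all-level quasi-  [refs: 10.4086/toc.2008.v004a007, 10.1016/j.jcss.2004.01.003, 10.1007/BF01263422, doi:10.4086/toc.2008.v004a007, doi:10.1016/j.jcss.2004.01.003, doi:10.1007/BF01263422]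

Barriers (technique_class: polynomial-method, smolensky, two-moduli, character-sums): - technique_class: polynomial-method, smolensky, two-moduli, character-sums
- Literature.Barriers.QuantumAdvantage.NonclassicalDegreeLogBarrier: does NOT bite L*'s filed rungs
(character-sum / Fourier-sparsity engine, no derivative or Gowers-norm step); it DOES cap derivative
methods on the dense core DenseFormsPolyLoss3Two (outputs of 𝔽₂-degree ≫ log n) — recorded on that
aside; H* is declared residual partly for this reason.
- Literature.Barriers.QuantumAdvantage.NaturalProofs: not in play — statements about explicit
polylog-degree 𝔽₃ polynomial maps vs an explicit relation (no pseudorandom function class contains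
the strategies considered); the route never argues about P/poly.
- Literature.Barriers.QuantumAdvantage.Algebrization: not in play — no oracles; white-box polynomial
method.
- Literature.Barriers.QuantumAdvantage.PromiseLiftRelativization: not in play — rung currency, no
promise lift.
- Literature.Barriers.QuantumAdvantage.QuantumNaturalProofs: not in play (classical polynomial
strategies only).
- Literature.Barriers.QuantumAdvantage.TwoModuliDepthTwo: EVADED on the special side L* — the
argument USES the prescribed MOD₃ tests (few-forms class measured by 𝔽₃-Fourier dimension of the
strategy's own linear forms; the character-sum engine `fourierLoss` and the proved rungs are
test-aware, relational and average-case), hence outside the test-oblivious depth-two device class;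
it BITES any test-oblivious dense-case argument on the generic side — which is why H* is the d

sub-problem: QuantumAdvantage · status: draft · opened planner-decomp-qadv-writer-1-g2-0 2026-08-30T04:53:54Z · rev 1 · ledger route-QuantumAdvantage-FormsDichotomy
GENERATED by the gate from the ledger (D-0016/17). Provers cite these decls: `theorem foo : Summit.QuantumAdvantage.QuantumAdvantage.Theses.FormsDichotomy.<Decl> := …` in Summits/QuantumAdvantage/QuantumAdvantage/Theorems/<Name>.lean.
-/

namespace Summit.QuantumAdvantage.QuantumAdvantage.Theses.FormsDichotomy

open scoped BigOperators Topology Manifold Classical MeasureTheory ProbabilityTheory Matrix InnerProductSpace ComplexConjugate ContinuousMap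
open Filter Set Function TopologicalSpace MeasureTheory

attribute [summit_statement] _root_.QuantumAdvantage
attribute [summit_statement] _root_.Summit.QuantumAdvantage.AdviceFreeQNC0.AdviceFreeQNC0Three

open Literature.QuantumAdvantage

/-- item stmt-QuantumAdvantage-26123 · target · rank 0 · open · by planner
why it might fail: a polylog-degree family winning 1 − n^−ω(1) (none known: every census family M0/M2 is few-forms and loses polynomially); it fails iff L* or H* fails.
sources: arXiv:1704.00690, doi:10.1145/28395.28404, arXiv:2408.16406
[crux] inverse-polynomial single-ring loss at every polylog degree: some k such that for every c,
for all large n, every single-ring 𝔽₃-strategy (z_i = [P_i(x) = 1], deg P_i ≤ (log₂ n)^c) satisfies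
the n-cycle relation RingHLF.Rel on at most (1 − n^(−k))·2^n of ALL 2^n inputs (plain count).
Strictly weaker than T (T ⇒ PolyLoss3, `polyLoss3_of_ringHardOdd`) and than AffineCore3's
constant-loss demand; degree-1 slice PROVED (`polyLossOne3`, from the tree's
AffBells37.affBellsPolyLoss3). [difficulty: L] -/
@[route_item "route-QuantumAdvantage-FormsDichotomy", crux]
def PolyLoss3 : Prop :=
  ∃ k : ℕ, ∀ c : ℕ, ∃ n₀ : ℕ, ∀ n ≥ n₀, ∀ P : Fin n → Literature.Computability.MetaComplexity.Smolensky.CubeFn (ZMod 3) n, (∀ i, P i ∈ Literature.Computability.MetaComplexity.Smolensky.lowDeg (ZMod 3) n ((Nat.log 2 n) ^ c)) → ((Finset.univ.filter fun x : Fin n → Bool => Literature.Computability.QuantumComplexity.RingHLF.Rel x (fun i => decide (P i x = 1))).card : ℝ) ≤ (1 - 1 / (n : ℝ) ^ k) * (2 : ℝ) ^ n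

/-- item stmt-QuantumAdvantage-28147 · crux · rank 2 · open · by planner
why it might fail: a level-2 few-forms family (tables on (log n)² staggered forms, spread spectrum) whose loss decays like n^−ω(1) — exactly the 9^−R room the Fourier method leaves (DenseFormsPolyLoss3Two is the core).
sources: arXiv:1704.00690, doi:10.1145/28395.28404, doi:10.1016/j.jcss.2004.01.003
[crux] L* (the SPECIAL side, NECESSARY, WEAKER, OPEN-but-CORNERED): some k such that at every level
c, for all large n, every polylog-degree strategy whose every output bit is a function of at most
(log₂ n)^c OWN linear forms mod 3 wins the ring game on at most (1 − n^−k)·2ⁿ of all patterns. Level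
1 PROVED (k = 8, tree `NPGamma37Proof.ringHardLinForms3_explicit` ⇒ node `fewFormsPolyLoss3_one`,
filed as aside FewFormsPolyLossOne3 = BC5 rung); quasi-poly loss PROVED at every level
(`fewForms_quasiLossOdd3`); local forms PROVED at every level (`localPolyLoss3`); open content =
quasi → poly at Fourier dimension (log n)^≥2. ATTACKABLE (engine `NPGamma37Proof.fourierLoss`;
spectral split L* ↔ SparseFormsPolyLoss3 a ∧ DenseFormsPolyLoss3 a PROVED every a) · INSTRUMENTABLE
(census C1: loss-exponent fit of few-forms families). [difficulty: L] -/
@[route_item "route-QuantumAdvantage-FormsDichotomy", crux (bottleneck := work) (source := "ledger D-0171 leaf tag ATTACKABLE on stmt-QuantumAdvantage-28147, 2026-09-01")]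
def FewFormsPolyLoss3 : Prop :=
  ∃ k : ℕ, ∀ c : ℕ, ∃ n₀ : ℕ, ∀ n ≥ n₀, ∀ Q : Fin n → Literature.Computability.MetaComplexity.Smolensky.CubeFn (ZMod 3) n, (∀ i, Q i ∈ Literature.Computability.MetaComplexity.Smolensky.lowDeg (ZMod 3) n ((Nat.log 2 n) ^ c)) → (∀ i, ∃ lam : Fin ((Nat.log 2 n) ^ c) → Fin n → ZMod 3, ∃ tab : (Fin ((Nat.log 2 n) ^ c) → ZMod 3) → Bool, ∀ x : Fin n → Bool, decide (Q i x = 1) = tab (fun j => ∑ k, if x k then lam j k else 0)) → ((Finset.univ.filter fun x : Fin n → Bool => Literature.Computability.QuantumComplexity.RingHLF.Rel x (fun i => decide (Q i x = 1))).card : ℝ) ≤ (1 - 1 / (n : ℝ) ^ k) * (2 : ℝ) ^ n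

/-- item stmt-QuantumAdvantage-28148 · crux · rank 3 · open · by planner
why it might fail: only together with PolyLoss3: a high-Fourier-dimension polylog-degree family winning 1 − n^−ω(1); structurally, inverse theorems for MOD₃-vs-parity correlation at degree ≳ log n are beyond every known bound.
sources: doi:10.4086/toc.2008.v004a007, doi:10.1109/FOCS.2008.18, arXiv:1704.00690, doi:10.1016/j.jcss.2004.01.003
[crux] H* (the GENERIC side, DECLARED RESIDUAL · NO-SHRINK ≡ PolyLoss3 mod L*; NECESSARY; hypotheses
satisfiable — generic degree-2 maps are n^−k-far from every few-forms map): for every closeness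
exponent k a loss exponent k′: at every level c, for all large n, every polylog-degree strategy
disagreeing with every special strategy of the same level on ≥ 2ⁿ/n^k patterns wins on at most (1 −
n^−k′)·2ⁿ — the INVERSE THEOREM «near-perfect ⇒ near-few-forms», typed form of NPGamma37's residual
«high 𝔽₃-Fourier dimension». IDEA-NEEDED (first rung: quadratic phases = ProductDial aside
PolyLossTwo3 26127; Bourgain / Viola–Wigderson parity-vs-MOD₃ sums decay like exp(−n/4^d), vacuous
at d ≳ log n); UNDECIDED with test census C2 (Fourier-dimension profile of near-optimal non-affine
families). [difficulty: open-problem] -/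
@[route_item "route-QuantumAdvantage-FormsDichotomy", crux (bottleneck := idea) (source := "ledger wanted_by.residual on stmt-QuantumAdvantage-28148, 2026-09-01")]
def FarFewFormsPolyLoss3 : Prop :=
  ∀ k : ℕ, ∃ k' : ℕ, ∀ c : ℕ, ∃ n₀ : ℕ, ∀ n ≥ n₀, ∀ P : Fin n → Literature.Computability.MetaComplexity.Smolensky.CubeFn (ZMod 3) n, (∀ i, P i ∈ Literature.Computability.MetaComplexity.Smolensky.lowDeg (ZMod 3) n ((Nat.log 2 n) ^ c)) → (∀ Q : Fin n → Literature.Computability.MetaComplexity.Smolensky.CubeFn (ZMod 3) n, (∀ i, Q i ∈ Literature.Computability.MetaComplexity.Smolensky.lowDeg (ZMod 3) n ((Nat.log 2 n) ^ c)) → (∀ i, ∃ lam : Fin ((Nat.log 2 n) ^ c) → Fin n → ZMod 3, ∃ tab : (Fin ((Nat.log 2 n) ^ c) → ZMod 3) → Bool, ∀ x : Fin n → Bool, decide (Q i x = 1) = tab (fun j => ∑ k, if x k then lam j k else 0)) → (2 : ℝ) ^ n / (n : ℝ) ^ k ≤ ((Finset.univ.filter fun x : Fin n → Bool => ∃ i,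 decide (P i x = 1) ≠ decide (Q i x = 1)).card : ℝ)) → ((Finset.univ.filter fun x : Fin n → Bool => Literature.Computability.QuantumComplexity.RingHLF.Rel x (fun i => decide (P i x = 1))).card : ℝ) ≤ (1 - 1 / (n : ℝ) ^ k') * (2 : ℝ) ^ n

/-- item stmt-QuantumAdvantage-26122 · support · rank 9 · open · by planner
sources: arXiv:1704.00690
[target] T* (the reformulated target, rank 0; assembly conclusion of layer 2): there are K and θ < 1
such that for every c, for all large n, every joint strategy for n^K rings of length n whose outputs
are 𝔽₃-polynomials of degree ≤ (log₂ n)^c in all n^K·n input bits wins all rings (each ring's output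
satisfies RingHLF.Rel) on at most θ·2^(n^K·n) input tuples. T → T* proved (node file
`multiRingHard3_of_ringHardOdd`); T* → PolyLoss3 proved (`polyLoss3_of_multiRingHard3`). [deps:
PolyLoss3, DPLift3] [difficulty: open-problem] -/
@[route_item "route-QuantumAdvantage-FormsDichotomy"]
def MultiRingHard3 : Prop :=
  ∃ K : ℕ, ∃ θ : ℝ, θ < 1 ∧ ∀ c : ℕ, ∃ n₀ : ℕ, ∀ n ≥ n₀, ∀ P : Fin (n ^ K) → Fin n → Literature.Computability.MetaComplexity.Smolensky.CubeFn (ZMod 3) (n ^ K * n), (∀ j i, P j i ∈ Literature.Computability.MetaComplexity.Smolensky.lowDeg (ZMod 3) (n ^ K * n) ((Nat.log 2 n) ^ c)) → ((Finset.univ.filter fun X : Fin (n ^ K) → Fin n → Bool => ∀ j, Literature.Computability.QuantumComplexity.RingHLF.Rel (X j) (fun i => decide (P j i (fun k => X (finProdFinEquiv.symm k).1 (finProdFinEquiv.symm k).2) = 1))).card : ℝ) ≤ θ * (2 : ℝ) ^ (n ^ K * n)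

/-- item stmt-QuantumAdvantage-26124 · crux · rank 4 · open · by planner
why it might fail: XOR/direct-product lemmas for polylog-degree 𝔽₃ polynomials against a RELATION are not in print; Viola–Wigderson-type products lose the degree budget.
sources: doi:10.4086/toc.2008.v004a007, arXiv:1704.00690
[crux] DECLARED-RESIDUAL (NO-SHRINK piece, critic row 9): the direct-product lift PolyLoss3 →
MultiRingHard3 — an inverse-polynomial loss per ring at every polylog degree amplifies, over n^K
disjoint rings read JOINTLY, to a constant all-rings bound. Proved special cases in the node file:
separable strategies (`dpSeparable3`) and triangular/causal reading orders (`dpTriangular3`,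
induction over rings via `card_winAllSet_triangular_le`); the symmetric cross-reading case is the
open content; constant-degree sub-rung DPLiftConst3 filed as aside. [deps: PolyLoss3] [difficulty:
open-problem] -/
@[route_item "route-QuantumAdvantage-FormsDichotomy", crux (bottleneck := idea) (source := "ledger D-0171 leaf tag IDEA-NEEDED on stmt-QuantumAdvantage-26124, 2026-09-01")]
def DPLift3 : Prop :=
  PolyLoss3 → MultiRingHard3

/-- item stmt-QuantumAdvantage-26125 · support · rank 9 · closed · proved by Summit.QuantumAdvantage.QuantumAdvantage.Theorems.pencilDial_multiRingBridge3 (prover) · by planner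
sources: arXiv:1704.00690, doi:10.1145/28395.28404
[support] LOAD-BEARING support (binder of `closes`; critic: staff/land FIRST): T* feeds the
registered leaf hypothesis — MultiRingHard3 → HLFNotFAC0Mod 3: restrict N×N 2D-HLF circuits over
accBasis 3 to instances carrying n^K disjoint square cycles of length n, turn the FAC⁰[3] circuit
tuple into ONE joint polylog-degree 𝔽₃-strategy for all rings at once by the relational
Razborov–Smolensky lemma (tree `Smolensky.exists_uniformProb_le`, error counted once for the whole
tuple), transfer HLF solutions to ring wins ring by ring (tree `GridCycle.rel_of_mem_hlfSolutions`),
exactly as the single-ring bridge `Theorems.hlfNotFAC0Mod_of_ringHard8` (RingFrameBridge.lean:119)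
with the packing of n^K cycles replacing one 8t-cycle. [difficulty: M] STATUS 2026-08-30 (record
correction): PROVED in a LAND-READY file — BridgeDial (lens-5 g6) Theorems/MultiRingBridge.lean
sha256 d782ca8a… (832 l, farm rc0 · 0 sorry): `Theorems.productDial_multiRingBridge3 :
ProductDial.MultiRingBridge3` (this shared decl — closes the item in all six routes) and
`adviceFreeQNC0Three_of_multiRingHard3 : MultiRingHard3 → AdviceFreeQNC0Three`; attached as evidence
on this item; LAND FIRST `ledger propose --kind proof -- -/
@[route_item "route-QuantumAdvantage-FormsDichotomy", crux]
def MultiRingBridge3 : Prop :=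
  MultiRingHard3 → Summit.QuantumAdvantage.AdviceFreeQNC0.HLFNotFAC0Mod 3

-- `MultiRingBridge3` holds: proved by `Summit.QuantumAdvantage.QuantumAdvantage.Theorems.pencilDial_multiRingBridge3` (its module imports this route file, so no `_holds` link can be stated here).

/-- item stmt-QuantumAdvantage-28149 · support · rank 9 · open · by planner
sources: arXiv:1704.00690
[support] the refines-glue X → T, PROVED in the node v3 (`formsSplitGlue3_holds := fun hL hH =>
node_iff_poly.mpr ⟨hL, hH⟩`, critic ACK 04:21:58Z; closable in one line by tree names once landed):
FewFormsPolyLoss3 → FarFewFormsPolyLoss3 → PolyLoss3 (close case with closeness exponent k_L+1, far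
case by H*, exponent max). [deps: FewFormsPolyLoss3, FarFewFormsPolyLoss3] [difficulty: S] -/
@[route_item "route-QuantumAdvantage-FormsDichotomy", crux]
def FormsSplitGlue3 : Prop :=
  FewFormsPolyLoss3 → FarFewFormsPolyLoss3 → PolyLoss3

/-- item stmt-QuantumAdvantage-28150 · aside · rank 9 · open · by planner
sources: arXiv:1704.00690
[support] aside — THE FIRST RUNG of L*, PROVED (node `fewFormsPolyLoss3_one` from tree
`NPGamma37Proof.ringHardLinForms3_explicit`, k = 8, N ≥ 200): level c = 1 (log₂ n own forms)
few-forms strategies lose polynomially. BC5 witness of the route (tree theorem by name; lies outside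
S's known regime: RingHardOdd 3 / PolyLoss3 are open at every level ≥ 1 for general strategies).
[difficulty: S] -/
@[route_item "route-QuantumAdvantage-FormsDichotomy"]
def FewFormsPolyLossOne3 : Prop :=
  ∃ k n₀ : ℕ, ∀ n ≥ n₀, ∀ Q : Fin n → Literature.Computability.MetaComplexity.Smolensky.CubeFn (ZMod 3) n, (∀ i, ∃ lam : Fin ((Nat.log 2 n) ^ 1) → Fin n → ZMod 3, ∃ tab : (Fin ((Nat.log 2 n) ^ 1) → ZMod 3) → Bool, ∀ x : Fin n → Bool, decide (Q i x = 1) = tab (fun j => ∑ k, if x k then lam j k else 0)) → ((Finset.univ.filter fun x : Fin n → Bool => Literature.Computability.QuantumComplexity.RingHLF.Rel x (fun i => decide (Q i x = 1))).card : ℝ) ≤ (1 - 1 / (n : ℝ) ^ k) * (2 : ℝ) ^ n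

/-- item stmt-QuantumAdvantage-28151 · aside · rank 9 · open · by planner
sources: arXiv:1704.00690, doi:10.1016/j.jcss.2004.01.003
[support] aside — the typed CEILING LIFT inside L* (ATTACKABLE, size M; = BC9 ceiling_lift): for
every sparsity exponent a ONE loss exponent at all levels for few-forms strategies whose tables have
≤ n^a nonzero 𝔽₄-Fourier coefficients (tree `NPGamma37Proof.fc`) — refactor `fourierLoss` with
support-indexed character families (K′ = (n+1)·2·(n^a+4F), loss n^−O(a) independent of R); NOT a
corollary of tree RingHardFourierSparse3 (monomial-support sparsity at R ≤ log₂N). a = 2 contains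
level 1 entirely (`sparseForms_two_of_fewForms_one`). [difficulty: M] -/
@[route_item "route-QuantumAdvantage-FormsDichotomy"]
def SparseFormsPolyLoss3All : Prop :=
  ∀ a : ℕ, ∃ k : ℕ, ∀ c : ℕ, ∃ n₀ : ℕ, ∀ n ≥ n₀, ∀ Q : Fin n → Literature.Computability.MetaComplexity.Smolensky.CubeFn (ZMod 3) n, (∀ i, Q i ∈ Literature.Computability.MetaComplexity.Smolensky.lowDeg (ZMod 3) n ((Nat.log 2 n) ^ c)) → ((∀ i, ∃ lam : Fin ((Nat.log 2 n) ^ c) → Fin n → ZMod 3, ∃ tab : (Fin ((Nat.log 2 n) ^ c) → ZMod 3) → Bool, ∀ x : Fin n → Bool, decide (Q i x = 1) = tab (fun j => ∑ k, if x k then lam j k else 0)) ∧ (∀ i, ∃ lam : Fin ((Nat.log 2 n) ^ c) → Fin n → ZMod 3, ∃ tab : (Fin ((Nat.log 2 n) ^ c) → ZMod 3) → Bool, (∀ x : Fin n → Bool, decide (Q i x = 1) = tab (fun j => ∑ k, if x k then lam j k else 0)) ∧ (Finset.univ.filter fun k : Fin ((Nat.log 2 n) ^ c) → ZMod 3 =>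 Summit.QuantumAdvantage.AdviceFreeQNC0.NPGamma37Proof.fc tab k ≠ 0).card ≤ n ^ a)) → ((Finset.univ.filter fun x : Fin n → Bool => Literature.Computability.QuantumComplexity.RingHLF.Rel x (fun i => decide (Q i x = 1))).card : ℝ) ≤ (1 - 1 / (n : ℝ) ^ k) * (2 : ℝ) ^ n

/-- item stmt-QuantumAdvantage-28152 · aside · rank 9 · open · by planner
sources: doi:10.1016/j.jcss.2004.01.003, doi:10.4086/toc.2008.v004a007
[support] aside — the IDEA-NEEDED CORE of L* at a = 2 (≡ L* mod SparseFormsPolyLoss3 2,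
`fewForms_spectral_split 2` PROVED; EMPTY at c ≤ 1 PROVED): few-forms strategies with some output
admitting no n²-sparse representation (balanced spread-spectrum tables of (log₂ n)^≥2 non-local
forms: majority / inner-product / random tables of MOD₃ tests) lose polynomially. No engine in the
tree reaches it (fourierLoss pays support size; derivative/Gowers methods capped by
NonclassicalDegreeLogBarrier; locality needs cyclically local supports). [difficulty: L] -/
@[route_item "route-QuantumAdvantage-FormsDichotomy"]
def DenseFormsPolyLoss3Two : Prop :=
  ∃ k : ℕ, ∀ c : ℕ, ∃ n₀ : ℕ, ∀ n ≥ n₀, ∀ Q : Fin n → Literature.Computability.MetaComplexity.Smolensky.CubeFn (ZMod 3) n, (∀ i, Q i ∈ Literature.Computability.MetaComplexity.Smolensky.lowDeg (ZMod 3) n ((Nat.log 2 n) ^ c)) → ((∀ i, ∃ lam : Fin ((Nat.log 2 n) ^ c) → Fin n → ZMod 3, ∃ tab : (Fin ((Nat.log 2 n) ^ c) → ZMod 3) → Bool, ∀ x : Fin n → Bool, decide (Q i x = 1) = tab (fun j => ∑ k, if x k then lam j k else 0)) ∧ ¬ (∀ i, ∃ lam : Fin ((Nat.log 2 n) ^ c)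 → Fin n → ZMod 3, ∃ tab : (Fin ((Nat.log 2 n) ^ c) → ZMod 3) → Bool, (∀ x : Fin n → Bool, decide (Q i x = 1) = tab (fun j => ∑ k, if x k then lam j k else 0)) ∧ (Finset.univ.filter fun k : Fin ((Nat.log 2 n) ^ c) → ZMod 3 => Summit.QuantumAdvantage.AdviceFreeQNC0.NPGamma37Proof.fc tab k ≠ 0).card ≤ n ^ 2)) → ((Finset.univ.filter fun x : Fin n → Bool => Literature.Computability.QuantumComplexity.RingHLF.Rel x (fun i => decide (Q i x = 1))).card : ℝ) ≤ (1 - 1 / (n : ℝ) ^ k) * (2 : ℝ) ^ n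

/-- item stmt-QuantumAdvantage-28153 · aside · rank 9 · open · by planner
sources: arXiv:1704.00690
[support] aside — the CONSTANT-grade twin of L* (g3's special binder; record of the grade ×
dimension table): few-forms strategies win at most θ·2ⁿ, one θ < 1 for all levels. [difficulty: L] -/
@[route_item "route-QuantumAdvantage-FormsDichotomy"]
def FewFormsHard3 : Prop :=
  ∃ θ : ℝ, θ < 1 ∧ ∀ c : ℕ, ∃ n₀ : ℕ, ∀ n ≥ n₀, ∀ Q : Fin n → Literature.Computability.MetaComplexity.Smolensky.CubeFn (ZMod 3) n, (∀ i, Q i ∈ Literature.Computability.MetaComplexity.Smolensky.lowDeg (ZMod 3) n ((Nat.log 2 n) ^ c)) → (∀ i, ∃ lam : Fin ((Nat.log 2 n) ^ c) → Fin n → ZMod 3, ∃ tab : (Fin ((Nat.log 2 n) ^ c) → ZMod 3) → Bool, ∀ x : Fin n → Bool, decide (Q i x = 1) = tab (fun j => ∑ k, if x k then lam j k else 0)) → ((Finset.univ.filter fun x : Fin n → Bool => Literature.Computability.QuantumComplexity.RingHLF.Rel x (fun i => decide (Q i x = 1))).card : ℝ) ≤ θ * (2 : ℝ) ^ n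

/-- item stmt-QuantumAdvantage-28154 · aside · rank 9 · open · by planner
sources: arXiv:1704.00690, doi:10.4086/toc.2008.v004a007
[support] aside — the CONSTANT-grade twin of H* (g3's generic binder; `closes_const` in the node
reaches the leaf from the two constant-grade twins via RingHard 3 directly). [difficulty:
open-problem] -/
@[route_item "route-QuantumAdvantage-FormsDichotomy"]
def FarFromFewFormsHard3 : Prop :=
  ∀ δ : ℝ, 0 < δ → ∃ θ : ℝ, θ < 1 ∧ ∀ c : ℕ, ∃ n₀ : ℕ, ∀ n ≥ n₀, ∀ P : Fin n → Literature.Computability.MetaComplexity.Smolensky.CubeFn (ZMod 3) n, (∀ i, P i ∈ Literature.Computability.MetaComplexity.Smolensky.lowDeg (ZMod 3) n ((Nat.log 2 n) ^ c)) → (∀ Q : Fin n → Literature.Computability.MetaComplexity.Smolensky.CubeFn (ZMod 3) n, (∀ i, Q i ∈ Literature.Computability.MetaComplexity.Smolensky.lowDeg (ZMod 3) n ((Nat.log 2 n) ^ c)) → (∀ i, ∃ lam : Fin ((Nat.log 2 n) ^ c) → Fin n → ZMod 3, ∃ tab : (Fin ((Nat.log 2 n) ^ c) → ZMod 3) → Bool,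 ∀ x : Fin n → Bool, decide (Q i x = 1) = tab (fun j => ∑ k, if x k then lam j k else 0)) → δ * (2 : ℝ) ^ n ≤ ((Finset.univ.filter fun x : Fin n → Bool => ∃ i, decide (P i x = 1) ≠ decide (Q i x = 1)).card : ℝ)) → ((Finset.univ.filter fun x : Fin n → Bool => Literature.Computability.QuantumComplexity.RingHLF.Rel x (fun i => decide (P i x = 1))).card : ℝ) ≤ θ * (2 : ℝ) ^ n

/-- item stmt-QuantumAdvantage-29203 · aside · rank 9 · open · by planner
why it might fail: a polylog-rank diagonal-quadratic family with loss n^{-ω(1)} (none known)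
sources: arXiv:1704.00690, doi:10.1145/28395.28404, kit:j337963
[aside] MidRankPolyLossTwo3 — THE MEET of the quadratic rung by 𝔽₃ CUBE-RANK (lens-2 g6 NODE
«RankDial» 2026-08-30T05:52:35Z, node decomp-qadv-lens-2/g6/RankDial.lean sha256 69f3a6ea…,
tree-ready support decomp-qadv-lens-2/g6/tree/RankDialForms.lean bae0c1ee…; critic
decomp-qadv-crit-1 rows 31/31v2 CLEARED 06:03:33Z/06:04:23Z: «ROUTE-EDIT FormsDichotomy: aside
MidRankPolyLossTwo3 (refuter-first junction, test C3′)»): ONE loss exponent k such that at EVERY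
level c, for all large n, every degree-≤2 strategy ALL of whose outputs are DIAGONAL quadratic
functions Σ_j (d_j ℓ_j² + b_j ℓ_j) + e of ≤ (log₂ n)^c own linear forms mod 3 (cube-rank ≤ (log₂
n)^c; `DiagForms` INLINED) wins the ring relation on at most (1 − n^{−k})·2ⁿ patterns. NECESSARY for
BOTH open binders it sits under — ORDER RECORDS (PROVED in the node): Mid ⟸ 28147 FewFormsPolyLoss3
(`mid_of_fewFormsPolyLoss3`), Mid ⟸ 26127 PolyLossTwo3 (`mid_of_polyLossTwo3`), Mid ⟸ 26123
PolyLoss3 (`mid_of_polyLoss3`); silent on non-quadratic tables and on high-rank quadratics (strictly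
below each). RUNGS PROVED (RankDialForms, LAND FIRST as Theorems/RankDialForms.lean): levels c ≤ 1
at poly loss (`lowRankPolyLossTwo3_le_one`, tree ringHa -/
@[route_item "route-QuantumAdvantage-FormsDichotomy"]
def MidRankPolyLossTwo3 : Prop :=
  ∃ k : ℕ, ∀ c : ℕ, ∃ n₀ : ℕ, ∀ n ≥ n₀, ∀ P : Fin n → Literature.Computability.MetaComplexity.Smolensky.CubeFn (ZMod 3) n, (∀ i, P i ∈ Literature.Computability.MetaComplexity.Smolensky.lowDeg (ZMod 3) n 2) → (∀ i, ∃ lam : Fin ((Nat.log 2 n) ^ c) → Fin n → ZMod 3, ∃ d b : Fin ((Nat.log 2 n) ^ c) → ZMod 3, ∃ e : ZMod 3, ∀ x : Fin n → Bool, P i x = (∑ j, (d j * (∑ t, if x t then lam j t else 0) ^ 2 + b j * (∑ t, if x t then lam j t else 0))) + e) → ((Finset.univ.filter fun x : Fin n → Bool => Literature.Computability.QuantumComplexity.RingHLF.Rel x (fun i => decide (P i x = 1))).card : ℝ) ≤ (1 - 1 / (n : ℝ) ^ k) * (2 : ℝ) ^ n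

/-- item stmt-QuantumAdvantage-29204 · aside · rank 9 · open · by planner
why it might fail: perfect quadratic strategies of cube-rank ≈ n/2 in an n-extensible family (census covariant rules sit at rank > N/2)
sources: arXiv:1704.00690, kit:j337947, kit:j337963
[aside] LowRankNotPerfectHalf3 := RankDialForms.LowRankNotPerfect3 rkHalf — DIAL RUNG under 27432
NoPerfectTwo3 at the HALF-RANK position (lens-2 g6 NODE «RankDial», critic row 31v2 preferred filing
(2): «aside LowRankNotPerfect3 rkHalf (dial rung under 27432, ATTACKABLE: engine extension; test
C3)»): for all large n, no degree-≤2 strategy ALL of whose outputs are diagonal quadratic functions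
of ≤ n/2 own linear forms mod 3 (cube-rank ≤ n/2; `DiagForms`/`rkHalf` INLINED) is perfect on the
odd class. WEAKER than 27432 (a restriction: ORDER RECORD Low_rkHalf ⟸ 27432 via
`noPerfectTwo3_iff_rank rkHalf`, PROVED in the node; NOT ≡ 27432 modulo anything proved — the
complementary HighRankNotPerfect3 rkHalf stays in the lens file, no mechanism) and strictly ABOVE
the PROVED position rkLin n = (n−8)/12 − 2·log₂ n (`lowRankNotPerfect3_lin`, RankDialForms; dial
monotonicity `lowRankNotPerfect3_anti`). ATTACKABLE: extend the Fourier-loss engine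
(linForms_not_perfectOdd3: 12R + 24·log₂N + 8 ≤ N) from n/12 to n/2 forms — a legitimate M/H rung,
constant improvement of an existing engine. TEST OF RECORD: census C3 — r₃*(N) := min over perfect
degree-2 strategies of max_i cube-rank(P_i), N = 8…12 -/
@[route_item "route-QuantumAdvantage-FormsDichotomy"]
def LowRankNotPerfectHalf3 : Prop :=
  ∃ n₀ : ℕ, ∀ n ≥ n₀, ∀ P : Fin n → Literature.Computability.MetaComplexity.Smolensky.CubeFn (ZMod 3) n, (∀ i, P i ∈ Literature.Computability.MetaComplexity.Smolensky.lowDeg (ZMod 3) n 2) → (∀ i, ∃ lam : Fin (n / 2) → Fin n → ZMod 3, ∃ d b : Fin (n / 2) → ZMod 3, ∃ e : ZMod 3, ∀ x : Fin n → Bool, P i x = (∑ j, (d j * (∑ t, if x t then lam j t else 0) ^ 2 + b j * (∑ t, if x t then lam j t else 0))) + e) → ∃ x : Fin n → Bool, Summit.QuantumAdvantage.AdviceFreeQNC0.OddZeros x ∧ ¬ Literature.Computability.QuantumComplexity.RingHLF.Rel x (fun i => decide (P i x = 1))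

/-- item stmt-QuantumAdvantage-28155 · assembly · rank 1 · open · by planner
sources: arXiv:1704.00690
[assembly] FewFormsPolyLoss3 → FarFewFormsPolyLoss3 → FormsSplitGlue3 → DPLift3 → MultiRingBridge3 →
AdviceFreeQNC0Three (`assembly_holds := closes`). -/
@[route_item "route-QuantumAdvantage-FormsDichotomy"]
def Assembly : Prop :=
  FewFormsPolyLoss3 → FarFewFormsPolyLoss3 → FormsSplitGlue3 → DPLift3 → MultiRingBridge3 → Summit.QuantumAdvantage.AdviceFreeQNC0.AdviceFreeQNC0Three

/-! D-0027 §2.1 — DECIDING THEOREM (planner-authored via `route open/edit --closes-file`; by planner-decomp-qadv-writer-1-g2-0 2026-08-30T04:53:54Z):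
its hypotheses are this route's items and its conclusion the registered leaf `Summit.QuantumAdvantage.AdviceFreeQNC0.AdviceFreeQNC0Three` (rung F-Q1-p3, D-0061) (glue_lint), and it elaborates with this file. -/

/-- Deciding theorem of route FormsDichotomy (decomp-qadv lens 2 gen 4, SHAPE B at F-Q1-p3): the PROVED refines-glue `FormsSplitGlue3`
turns the special side L* = `FewFormsPolyLoss3` and the declared residual H* = `FarFewFormsPolyLoss3` into ProductDial's crux `PolyLoss3`;
ProductDial's residual `DPLift3` gives T* = `MultiRingHard3`, its proved bridge `MultiRingBridge3` gives `HLFNotFAC0Mod 3`, and the landed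
`Theorems.adviceFreeQNC0Sep_of_hlfNotFAC0Mod` with `adviceFreeQNC0Three_iff` concludes the rung leaf F-Q1-p3. -/
@[closes "route-QuantumAdvantage-FormsDichotomy"] theorem closes (hL : FewFormsPolyLoss3) (hH : FarFewFormsPolyLoss3) (hG : FormsSplitGlue3) (hD : DPLift3) (hB : MultiRingBridge3) :
    Summit.QuantumAdvantage.AdviceFreeQNC0.AdviceFreeQNC0Three :=
  Summit.QuantumAdvantage.AdviceFreeQNC0.adviceFreeQNC0Three_iff.mpr
    (Summit.QuantumAdvantage.QuantumAdvantage.Theorems.adviceFreeQNC0Sep_of_hlfNotFAC0Mod 3 (hB (hD (hG hL hH))))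

end Summit.QuantumAdvantage.QuantumAdvantage.Theses.FormsDichotomy
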